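import Literature.AlgebraicGeometry.Motives.AbelianVarietyWeilPairingBaseChange
import Literature.AlgebraicGeometry.Motives.AbelianVarietyWeilPairingPullback
import Literature.AlgebraicGeometry.Motives.AbelianVarietyWeilPairingDivisorClass
import Literature.AlgebraicGeometry.Motives.AbelianVarietyBaseChangeTowerFst
import Literature.AlgebraicGeometry.Motives.AbelianVarietyTorsionPointsAlgClosed
import HarnessLib

/-!
# Identities between level Weil pairings descend from `Ω`-points to `k̄`-points
# (Serre–Tate 1968 §1: `A_m ⊂ A(K_s)`; Lang VII §2: `e_N` is defined over the ground field)

Layer `Literature/AlgebraicGeometry/Motives`, namespace `Literature.AlgebraicGeometry.Motives.AbelianVariety`.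
KERNEL ONLY: theorems; no definition, no instance, no named fact, no `sorry`.

Let `A` be an abelian variety over a field `k`, `k̄ = AlgebraicClosure k`, `Ω ⊇ k̄` algebraically closed
(`[Algebra k Ω] [Algebra k̄ Ω] [IsScalarTower k k̄ Ω]`, e.g. `Ω = ℂ`), `N` invertible in `k`, and `Y₁, Y₂` Cartier divisors
on `A`.  Every `N`-torsion point of `A_Ω(Ω)` comes from an `N`-torsion point of `A(k̄)`
(`Motives/AbelianVarietyTorsionPointsAlgClosed`), and the level-`N` Weil pairings of `Y_Ω = pr^* Y` on `A_Ω` at such points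
are the images under `k̄ → Ω` of those of `Y_{k̄}` on `A_{k̄}` (`weilPairingLevel_baseChange_eq_algebraMap_of_over`, from
`Motives/AbelianVarietyWeilPairingBaseChange` through the tower `(A ⊗ k̄) ⊗ Ω ≅ A ⊗ Ω`,
`Motives/AbelianVarietyBaseChangeTowerFst`).  Consequently an identity of the shape

  `ē_N^{Y₁}(P, Q) = ē_N^{Y₂}(P, Q)^q` for all `P, Q ∈ A_{k̄}[N](k̄)`

implies the same identity for all `P, Q ∈ A_Ω[N](Ω)` (**`weilPairingLevel_eq_pow_of_algClosure`**).

Use (cell `hodgecm-mathlib`, row II-1 `shimura1998_thm18_6` v2, stub S5 `StubPolarisationTransport`, B-p20): the reduction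
argument «`E_ℓ(κ⁻¹X^σ) = E_ℓ(pX)`» [Shimura1998 p0168 L4] lives on `L̄`-points (Tate modules), the uniformisations on
ℂ-points; this file carries the conclusion from the former to the latter.

## References
* [SerreTate1968] J.-P. Serre, J. Tate, *Good reduction of abelian varieties*, Ann. of Math. 88 (1968), §1 p. 493.
* [Lang1983AbelianVarieties] S. Lang, *Abelian Varieties*, Ch. VII §2 Prop. 3.
* [GortzWedhorn2020] U. Görtz, T. Wedhorn, *Algebraic Geometry I*, Prop. 4.16, §(4.7)–(4.8).
-/

universe u

open CategoryTheory CategoryTheory.Limits AlgebraicGeometry MonoidalCategory CartesianMonoidalCategory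

noncomputable section

namespace Literature.AlgebraicGeometry.Motives

open scoped MonObj
open RatFn

namespace AbelianVariety

/-- The underlying scheme morphism of an isomorphism of abelian varieties is dominant (it is surjective:
`e⁻¹ ≫ e = 𝟙`). [cite: GortzWedhorn2020, Prop. 4.16 and §(4.8)] -/
theorem isDominant_toSchemeHom_iso_hom {K : Type u} [Field K] {B C : AbelianVariety K} (e : B ≅ C) :
    IsDominant (Hom.toSchemeHom e.hom) := by
  refine ⟨(show Function.Surjective (Hom.toSchemeHom e.hom).base from fun y => ?_).denseRange⟩
  refine ⟨Hom.toSchemeHom e.inv y, ?_⟩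
  rw [← Scheme.Hom.comp_apply]
  change Hom.toSchemeHom (e.inv ≫ e.hom) y = y
  rw [e.inv_hom_id]
  rfl

/-- **The tower isomorphism identifies the two readings of a `k′`-point as an `S`-point**: for `t ∈ A(k′)`,
the `S`-point of `(A ⊗_k k′) ⊗_{k′} S` attached to `t ∈ A_{k′}(k′) ⊆ A_{k′}(S)` is carried by
`e_A : (A ⊗ k′) ⊗ S ≅ A ⊗ S` to the `S`-point of `A ⊗_k S` attached to `t ∈ A(k′) ⊆ A(S)` — both lie over the
same `S`-point of `A` because `e_A ≫ pr_A = pr ≫ pr_A` (`toSchemeHom_baseChangeTowerIso_hom_comp_fst`).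
[cite: GortzWedhorn2020, Prop. 4.16 and §(4.7)–(4.8)] -/
theorem map_baseChangeTowerIso_pointsMulEquiv_extendScalars (k k' S : Type u) [Field k] [Field k'] [Field S]
    [Algebra k k'] [Algebra k' S] [Algebra k S] [IsScalarTower k k' S] (A : AbelianVariety k) (t : A.Points k') :
    AlgPoints.map (baseChangeTowerIso k k' S A).hom.hom.hom.hom
        ((A.baseChange k').pointsMulEquiv S
          (AlgPoints.extendScalars (A.baseChange k').X k' S (A.pointsMulEquiv k' t))) =
      A.pointsMulEquiv S (AlgPoints.extendScalars A.X k' S t) := by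
  -- the projections as variables on the abelian-variety-typed schemes (design note of
  -- `Motives/AbelianVarietyWeilPairingConjugate`)
  obtain ⟨π', hπ'⟩ : ∃ π : ((A.baseChange k').baseChange S).X.left ⟶ (A.baseChange k').X.left,
      π = pullback.fst (A.baseChange k').X.hom (bcSpec k' S) := ⟨_, rfl⟩
  obtain ⟨πc, hπc⟩ : ∃ π : (A.baseChange k').X.left ⟶ A.X.left, π = pullback.fst A.X.hom (bcSpec k k') :=
    ⟨_, rfl⟩
  have hsq : Hom.toSchemeHom (baseChangeTowerIso k k' S A).hom ≫ pullback.fst A.X.hom (bcSpec k S) = π' ≫ πc := by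
    rw [hπ', hπc]
    exact toSchemeHom_baseChangeTowerIso_hom_comp_fst k k' S A
  have hQ : (A.pointsMulEquiv k' t : (A.baseChange k').Points k').left ≫ πc = t.left := by
    rw [hπc, pointsMulEquiv_apply]
    exact A.pointsEquiv_apply_left_comp_fst k' t
  have hP : ((A.baseChange k').pointsMulEquiv S
      (AlgPoints.extendScalars (A.baseChange k').X k' S (A.pointsMulEquiv k' t)) :
        ((A.baseChange k').baseChange S).Points S).left ≫ π' =
      bcSpec k' S ≫ (A.pointsMulEquiv k' t : (A.baseChange k').Points k').left := by
    rw [hπ']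
    exact (A.baseChange k').pointsMulEquiv_left_comp_eq S _ _ rfl
  -- compare the underlying `S`-points of `A`
  refine ((A.pointsMulEquiv S).symm_apply_eq).1 (Over.OverMorphism.ext ?_)
  change ((A.pointsEquiv S).symm (AlgPoints.map (baseChangeTowerIso k k' S A).hom.hom.hom.hom _)).left = _
  rw [pointsEquiv_symm_apply_left, AlgPoints.map_apply, Over.comp_left, Category.assoc]
  change _ ≫ Hom.toSchemeHom (baseChangeTowerIso k k' S A).hom ≫ pullback.fst A.X.hom (bcSpec k S) = _
  rw [hsq, ← Category.assoc, hP, AlgPoints.extendScalars_apply, Over.comp_left, AlgPoints.specOverMap_left, ← hQ]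
  exact Category.assoc _ _ _

/-! ### Torsion points over an algebraically closed field -/

section AlgClosure

variable {k : Type u} [Field k] (Ω : Type u) [Field Ω] [Algebra k Ω]
  [Algebra (AlgebraicClosure k) Ω] [IsScalarTower k (AlgebraicClosure k) Ω] (A : AbelianVariety k)

/-- **A torsion point of `A_Ω(Ω)` read through the tower `(A ⊗ k̄) ⊗ Ω ≅ A ⊗ Ω` lies over a torsion point of
`A_{k̄}(k̄)`**: for `P ∈ A_Ω[N](Ω)` (`N` invertible in `k`) there are `Q₀ ∈ A_{k̄}[N](k̄)` and `P' ∈ ((A ⊗ k̄) ⊗ Ω)[N](Ω)`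
with `e(P') = P` and `P' ≫ pr = (Spec Ω → Spec k̄) ≫ Q₀` (`A_m ⊂ A(K_s)`, Serre–Tate §1;
`exists_extendScalars_eq_of_mem_torsionPoints`). [cite: SerreTate1968, §1 p. 493] -/
theorem exists_over_algClosure_of_mem_torsionPoints [IsAlgClosed Ω] {N : ℕ} (hN : (N : k) ≠ 0)
    (π' : ((A.baseChange (AlgebraicClosure k)).baseChange Ω).X.left ⟶ (A.baseChange (AlgebraicClosure k)).X.left)
    (hπ' : π' = pullback.fst (A.baseChange (AlgebraicClosure k)).X.hom (bcSpec (AlgebraicClosure k) Ω))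
    (P : (A.baseChange Ω).torsionPoints Ω N) :
    ∃ (Q₀ : (A.baseChange (AlgebraicClosure k)).torsionPoints (AlgebraicClosure k) N)
      (P' : ((A.baseChange (AlgebraicClosure k)).baseChange Ω).torsionPoints Ω N),
      (P : (A.baseChange Ω).Points Ω) =
          AlgPoints.map (baseChangeTowerIso k (AlgebraicClosure k) Ω A).hom.hom.hom.hom P'.1 ∧
        (P'.1 : ((A.baseChange (AlgebraicClosure k)).baseChange Ω).Points Ω).left ≫ π' =
          bcSpec (AlgebraicClosure k) Ω ≫ (Q₀.1 : (A.baseChange (AlgebraicClosure k)).Points (AlgebraicClosure k)).left := by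
  -- the `Ω`-point `s` of `A` under `P` is torsion, hence `k̄`-rational: `s = extendScalars t`
  obtain ⟨s, hs⟩ := (A.pointsMulEquiv Ω).surjective (P : (A.baseChange Ω).Points Ω)
  have hsN : s ∈ A.torsionPoints Ω (N : ℤ) := by
    rw [mem_torsionPoints_iff, ← (A.pointsMulEquiv Ω).map_eq_one_iff, map_zpow, hs]
    exact (mem_torsionPoints_iff _ _).1 P.2
  have hNz : ((N : ℤ) : k) ≠ 0 := by exact_mod_cast hN
  obtain ⟨t, htN, hts⟩ := A.exists_extendScalars_eq_of_mem_torsionPoints Ω hNz hsN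
  -- `Q₀ := t ∈ A_{k̄}(k̄)` and `P' := Q₀ ∈ A_{k̄}(Ω) = ((A ⊗ k̄) ⊗ Ω)(Ω)`, both torsion
  have hQ₀N : A.pointsMulEquiv (AlgebraicClosure k) t ∈
      (A.baseChange (AlgebraicClosure k)).torsionPoints (AlgebraicClosure k) (N : ℤ) := by
    rw [mem_torsionPoints_iff, ← map_zpow, (mem_torsionPoints_iff _ _).1 htN, map_one]
  have hP'N : (A.baseChange (AlgebraicClosure k)).pointsMulEquiv Ω
      (AlgPoints.extendScalars (A.baseChange (AlgebraicClosure k)).X (AlgebraicClosure k) Ω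
        (A.pointsMulEquiv (AlgebraicClosure k) t)) ∈
      ((A.baseChange (AlgebraicClosure k)).baseChange Ω).torsionPoints Ω (N : ℤ) := by
    rw [mem_torsionPoints_iff, ← map_zpow, ← AlgPoints.extendScalarsMonoidHom_apply, ← map_zpow,
      (mem_torsionPoints_iff _ _).1 hQ₀N, map_one, map_one]
  refine ⟨⟨_, hQ₀N⟩, ⟨_, hP'N⟩, ?_, ?_⟩
  · rw [map_baseChangeTowerIso_pointsMulEquiv_extendScalars, hts, hs]
  · rw [hπ']
    exact (A.baseChange (AlgebraicClosure k)).pointsMulEquiv_left_comp_eq Ω _ _ rfl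

/-- **The Weil pairing of `Y_Ω` at points over `k̄`-points is the image of the Weil pairing of `Y_{k̄}`** (through the
tower `(A ⊗ k̄) ⊗ Ω ≅ A ⊗ Ω`: `weilPairingLevel_pullback_eq` along the tower isomorphism, then
`weilPairingLevel_baseChange` for `Ω / k̄`). [cite: Lang1983AbelianVarieties, Ch. VII §2 Prop. 3] -/
theorem weilPairingLevel_baseChange_eq_algebraMap_of_over {N : ℕ}
    (πΩ : (A.baseChange Ω).X.left ⟶ A.X.left) (hπΩ : πΩ = pullback.fst A.X.hom (bcSpec k Ω)) [IsDominant πΩ]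
    (πc : (A.baseChange (AlgebraicClosure k)).X.left ⟶ A.X.left)
    (hπc : πc = pullback.fst A.X.hom (bcSpec k (AlgebraicClosure k))) [IsDominant πc]
    (π' : ((A.baseChange (AlgebraicClosure k)).baseChange Ω).X.left ⟶ (A.baseChange (AlgebraicClosure k)).X.left)
    (hπ' : π' = pullback.fst (A.baseChange (AlgebraicClosure k)).X.hom (bcSpec (AlgebraicClosure k) Ω)) [IsDominant π']
    [IsDominant (Hom.toSchemeHom ((N : ℤ) • 𝟙 (A.baseChange Ω)))]
    [IsDominant (Hom.toSchemeHom ((N : ℤ) • 𝟙 (A.baseChange (AlgebraicClosure k))))]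
    [IsDominant (Hom.toSchemeHom ((N : ℤ) • 𝟙 ((A.baseChange (AlgebraicClosure k)).baseChange Ω)))]
    (Y : CartierDivisor A.X.left)
    (Q₀ R₀ : (A.baseChange (AlgebraicClosure k)).torsionPoints (AlgebraicClosure k) N)
    (P' R' : ((A.baseChange (AlgebraicClosure k)).baseChange Ω).torsionPoints Ω N)
    (P R : (A.baseChange Ω).torsionPoints Ω N)
    (hP : (P : (A.baseChange Ω).Points Ω) = AlgPoints.map (baseChangeTowerIso k (AlgebraicClosure k) Ω A).hom.hom.hom.hom P'.1)
    (hR : (R : (A.baseChange Ω).Points Ω) = AlgPoints.map (baseChangeTowerIso k (AlgebraicClosure k) Ω A).hom.hom.hom.hom R'.1)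
    (hP' : (P'.1 : ((A.baseChange (AlgebraicClosure k)).baseChange Ω).Points Ω).left ≫ π' =
      bcSpec (AlgebraicClosure k) Ω ≫ (Q₀.1 : (A.baseChange (AlgebraicClosure k)).Points (AlgebraicClosure k)).left)
    (hR' : (R'.1 : ((A.baseChange (AlgebraicClosure k)).baseChange Ω).Points Ω).left ≫ π' =
      bcSpec (AlgebraicClosure k) Ω ≫ (R₀.1 : (A.baseChange (AlgebraicClosure k)).Points (AlgebraicClosure k)).left) :
    (A.baseChange Ω).weilPairingLevel (Y.pullback πΩ) P R =
      algebraMap (AlgebraicClosure k) Ω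
        ((A.baseChange (AlgebraicClosure k)).weilPairingLevel (Y.pullback πc) Q₀ R₀) := by
  set e := baseChangeTowerIso k (AlgebraicClosure k) Ω A with he
  haveI : IsDominant (Hom.toSchemeHom e.hom) := isDominant_toSchemeHom_iso_hom e
  -- along the tower isomorphism: `ē^{Y_Ω}(P, R) = ē^{e^* Y_Ω}(P', R')`
  rw [← weilPairingLevel_pullback_eq e.hom (Y.pullback πΩ) P' R' P R hP hR]
  -- `e^* Y_Ω` and `pr'^* Y_{k̄}` are the same divisor (`e ≫ pr_Ω = pr' ≫ pr_{k̄}`)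
  have hsq : Hom.toSchemeHom e.hom ≫ πΩ = π' ≫ πc := by
    rw [hπΩ, hπ', hπc]
    exact toSchemeHom_baseChangeTowerIso_hom_comp_fst k (AlgebraicClosure k) Ω A
  haveI : IsDominant (Hom.toSchemeHom e.hom ≫ πΩ) := inferInstance
  haveI : IsDominant (π' ≫ πc) := inferInstance
  have hdiv : ((Y.pullback πΩ).pullback (Hom.toSchemeHom e.hom)).SameDivisor ((Y.pullback πc).pullback π') :=
    ((Y.pullback_pullback_sameDivisor _ _).trans (Y.pullback_congr_sameDivisor hsq)).trans
      (Y.pullback_pullback_sameDivisor _ _).symm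
  rw [weilPairingLevel_congr_sameDivisor hdiv]
  -- base change `Ω / k̄`
  exact weilPairingLevel_baseChange Ω (A.baseChange (AlgebraicClosure k)) π' hπ' (Y.pullback πc) Q₀ R₀ P' R' hP' hR'

/-- **Identities between level Weil pairings descend from `k̄`-points to `Ω`-points**: if for two divisors `Y₁, Y₂` on
`A` and an exponent `q` one has `ē_N^{Y₁}(Q, R) = ē_N^{Y₂}(Q, R)^q` for all `N`-torsion points of `A_{k̄}(k̄)` (`N` invertible in
`k`), then `ē_N^{Y₁}(P, R) = ē_N^{Y₂}(P, R)^q` for all `N`-torsion points of `A_Ω(Ω)`, `Ω ⊇ k̄` algebraically closed — every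
such point lies over a `k̄`-point (Serre–Tate §1) and the pairings are transported by `k̄ → Ω` (Lang VII §2).
[cite: SerreTate1968, §1 p. 493] [cite: Lang1983AbelianVarieties, Ch. VII §2 Prop. 3] -/
theorem weilPairingLevel_eq_pow_of_algClosure [IsAlgClosed Ω] {N : ℕ} (hN : (N : k) ≠ 0)
    (πΩ : (A.baseChange Ω).X.left ⟶ A.X.left) (hπΩ : πΩ = pullback.fst A.X.hom (bcSpec k Ω)) [IsDominant πΩ]
    (πc : (A.baseChange (AlgebraicClosure k)).X.left ⟶ A.X.left)
    (hπc : πc = pullback.fst A.X.hom (bcSpec k (AlgebraicClosure k))) [IsDominant πc]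
    (π' : ((A.baseChange (AlgebraicClosure k)).baseChange Ω).X.left ⟶ (A.baseChange (AlgebraicClosure k)).X.left)
    (hπ' : π' = pullback.fst (A.baseChange (AlgebraicClosure k)).X.hom (bcSpec (AlgebraicClosure k) Ω)) [IsDominant π']
    [IsDominant (Hom.toSchemeHom ((N : ℤ) • 𝟙 (A.baseChange Ω)))]
    [IsDominant (Hom.toSchemeHom ((N : ℤ) • 𝟙 (A.baseChange (AlgebraicClosure k))))]
    [IsDominant (Hom.toSchemeHom ((N : ℤ) • 𝟙 ((A.baseChange (AlgebraicClosure k)).baseChange Ω)))]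
    (Y₁ Y₂ : CartierDivisor A.X.left) (q : ℕ)
    (h : ∀ Q R : (A.baseChange (AlgebraicClosure k)).torsionPoints (AlgebraicClosure k) N,
      (A.baseChange (AlgebraicClosure k)).weilPairingLevel (Y₁.pullback πc) Q R =
        (A.baseChange (AlgebraicClosure k)).weilPairingLevel (Y₂.pullback πc) Q R ^ q)
    (P R : (A.baseChange Ω).torsionPoints Ω N) :
    (A.baseChange Ω).weilPairingLevel (Y₁.pullback πΩ) P R = (A.baseChange Ω).weilPairingLevel (Y₂.pullback πΩ) P R ^ q := by
  obtain ⟨Q₀, P', hP, hP'⟩ := A.exists_over_algClosure_of_mem_torsionPoints Ω hN π' hπ' P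
  obtain ⟨R₀, R', hR, hR'⟩ := A.exists_over_algClosure_of_mem_torsionPoints Ω hN π' hπ' R
  rw [A.weilPairingLevel_baseChange_eq_algebraMap_of_over Ω πΩ hπΩ πc hπc π' hπ' Y₁ Q₀ R₀ P' R' P R hP hR hP' hR',
    A.weilPairingLevel_baseChange_eq_algebraMap_of_over Ω πΩ hπΩ πc hπc π' hπ' Y₂ Q₀ R₀ P' R' P R hP hR hP' hR', h Q₀ R₀,
    map_pow]

/-! ### Pull-back form: an identity for `f^* Y` against `X` on `k̄`-points gives `ē^{Y}(fP, fQ) = ē^{X}(P, Q)^q` on `Ω`-points -/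

/-- `[N]` is dominant on (any base change of) an abelian variety when `N` is invertible in the ground field
(it is an isogeny, `isIsogeny_zsmul_id_of_cast_ne_zero`, hence surjective). [cite: MumfordAV1970, §6 Proposition p. 64] -/
theorem isDominant_toSchemeHom_zsmul_of_ne_zero {K : Type u} [Field K] (B : AbelianVariety K) {N : ℕ}
    (hN : (N : K) ≠ 0) : IsDominant (Hom.toSchemeHom ((N : ℤ) • 𝟙 B)) :=
  ⟨(B.isIsogeny_zsmul_id_of_cast_ne_zero (N : ℤ) (by exact_mod_cast hN)).1.1.denseRange⟩

omit [Algebra (AlgebraicClosure k) Ω] [IsScalarTower k (AlgebraicClosure k) Ω] in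
/-- **Pull-back form of the descent `k̄ ⇒ Ω`**: for a homomorphism `f : A → B` over `k`, divisors `Y` on `B` and
`X` on `A`, and `N` invertible in `k`: if `ē_N^{f^*Y}(x, y) = ē_N^{X}(x, y)^q` for all `N`-torsion points of
`A_{k̄}(k̄)`, then `ē_N^{Y_Ω}(f P, f Q) = ē_N^{X_Ω}(P, Q)^q` for all `N`-torsion points `P, Q` of `A_Ω(Ω)`, `Ω ⊇ k`
algebraically closed (`ē^{Y}(fP, fQ) = ē^{f^*Y}(P, Q)`, Mumford §20 (3); then
`weilPairingLevel_eq_pow_of_algClosure` through an embedding `k̄ → Ω`, Serre–Tate §1). In the cell's use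
(`f = κ : A₀ → A₀^γ`, `Y = X^γ`, `Ω = ℂ`) this carries Shimura's «`E_ℓ(κ⁻¹(X^σ)) = E_ℓ(pX)`» (p. 130) from
`L̄`-points to the uniformised complex points. [cite: SerreTate1968, §1 p. 493]
[cite: MumfordAV1970, §20 (property (3) of e_n, p. 186)] -/
theorem weilPairingLevel_map_eq_pow_of_algClosure [IsAlgClosed Ω] {B : AbelianVariety k} (f : A ⟶ B)
    [IsDominant (Hom.toSchemeHom f)] [IsDominant (Hom.toSchemeHom (Hom.baseChange Ω f))] {N : ℕ} (hN : (N : k) ≠ 0)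
    (πA : (A.baseChange Ω).X.left ⟶ A.X.left) (hπA : πA = pullback.fst A.X.hom (bcSpec k Ω)) [IsDominant πA]
    (πB : (B.baseChange Ω).X.left ⟶ B.X.left) (hπB : πB = pullback.fst B.X.hom (bcSpec k Ω)) [IsDominant πB]
    (πc : (A.baseChange (AlgebraicClosure k)).X.left ⟶ A.X.left)
    (hπc : πc = pullback.fst A.X.hom (bcSpec k (AlgebraicClosure k))) [IsDominant πc]
    [IsDominant (Hom.toSchemeHom ((N : ℤ) • 𝟙 (A.baseChange Ω)))]
    [IsDominant (Hom.toSchemeHom ((N : ℤ) • 𝟙 (B.baseChange Ω)))]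
    [IsDominant (Hom.toSchemeHom ((N : ℤ) • 𝟙 (A.baseChange (AlgebraicClosure k))))]
    (Y : CartierDivisor B.X.left) (X : CartierDivisor A.X.left) (q : ℕ)
    (h : ∀ x y : (A.baseChange (AlgebraicClosure k)).torsionPoints (AlgebraicClosure k) N,
      (A.baseChange (AlgebraicClosure k)).weilPairingLevel ((Y.pullback (Hom.toSchemeHom f)).pullback πc) x y =
        (A.baseChange (AlgebraicClosure k)).weilPairingLevel (X.pullback πc) x y ^ q)
    (P Q : (A.baseChange Ω).torsionPoints Ω N) (P' Q' : (B.baseChange Ω).torsionPoints Ω N)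
    (hP' : (P' : (B.baseChange Ω).Points Ω) = AlgPoints.map (Hom.baseChange Ω f).hom.hom.hom P.1)
    (hQ' : (Q' : (B.baseChange Ω).Points Ω) = AlgPoints.map (Hom.baseChange Ω f).hom.hom.hom Q.1) :
    (B.baseChange Ω).weilPairingLevel (Y.pullback πB) P' Q' =
      (A.baseChange Ω).weilPairingLevel (X.pullback πA) P Q ^ q := by
  -- `ē^{Y_Ω}(fP, fQ) = ē^{f_Ω^* Y_Ω}(P, Q)` and `f_Ω^* Y_Ω = (f^* Y)_Ω` (same divisor: `f_Ω ≫ pr_B = pr_A ≫ f`)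
  rw [← weilPairingLevel_pullback_eq (Hom.baseChange Ω f) (Y.pullback πB) P Q P' Q' hP' hQ']
  have hsq : Hom.toSchemeHom (Hom.baseChange Ω f) ≫ πB = πA ≫ Hom.toSchemeHom f := by
    rw [hπA, hπB]
    exact toSchemeHom_baseChange_comp_fst Ω f
  haveI : IsDominant (Hom.toSchemeHom (Hom.baseChange Ω f) ≫ πB) := inferInstance
  haveI : IsDominant (πA ≫ Hom.toSchemeHom f) := inferInstance
  have hdiv : ((Y.pullback πB).pullback (Hom.toSchemeHom (Hom.baseChange Ω f))).SameDivisor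
      ((Y.pullback (Hom.toSchemeHom f)).pullback πA) :=
    ((Y.pullback_pullback_sameDivisor _ _).trans (Y.pullback_congr_sameDivisor hsq)).trans
      (Y.pullback_pullback_sameDivisor _ _).symm
  rw [weilPairingLevel_congr_sameDivisor hdiv]
  -- an embedding `k̄ → Ω` over `k`, and the descent `k̄ ⇒ Ω` for the two divisors `f^* Y`, `X` on `A`
  letI : Algebra (AlgebraicClosure k) Ω := (IsAlgClosed.lift : AlgebraicClosure k →ₐ[k] Ω).toRingHom.toAlgebra
  haveI : IsScalarTower k (AlgebraicClosure k) Ω :=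
    IsScalarTower.of_algebraMap_eq fun x => ((IsAlgClosed.lift : AlgebraicClosure k →ₐ[k] Ω).commutes x).symm
  obtain ⟨π', hπ'⟩ : ∃ π : ((A.baseChange (AlgebraicClosure k)).baseChange Ω).X.left ⟶
      (A.baseChange (AlgebraicClosure k)).X.left,
      π = pullback.fst (A.baseChange (AlgebraicClosure k)).X.hom (bcSpec (AlgebraicClosure k) Ω) := ⟨_, rfl⟩
  haveI : IsDominant π' := by
    rw [hπ']
    exact (A.baseChange (AlgebraicClosure k)).isDominant_baseChangeFst Ω
  haveI : IsDominant (Hom.toSchemeHom ((N : ℤ) • 𝟙 ((A.baseChange (AlgebraicClosure k)).baseChange Ω))) :=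
    isDominant_toSchemeHom_zsmul_of_ne_zero _ (by
      rw [← map_natCast (algebraMap k Ω)]
      exact (map_ne_zero_iff _ (algebraMap k Ω).injective).2 hN)
  exact A.weilPairingLevel_eq_pow_of_algClosure Ω hN πA hπA πc hπc π' hπ' (Y.pullback (Hom.toSchemeHom f)) X q h P Q

end AlgClosure

end AbelianVariety

end Literature.AlgebraicGeometry.Motives

end
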